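import Summits.AtomisticToContinuum.Crystallization.Theorems.FrustratedLawDichotomyStrainedPatchHomValueT2SlopeSoundP
import Summits.AtomisticToContinuum.Crystallization.Theorems.FrustratedLawDichotomyStrainedPatchHomValueT2SoundZT

/-!
# (I1) slope part Q — SOCKET PLUMBING: the track hypotheses of `slopeT2_sound` / `valueLeafT2T_sound` from the affine track `hξσ`
# (`…HomValueT2Track` §13–§14b; critic row 1674 (B) (I1); 27623 `(H) HomFloor`, hcp half; decomp-a2c hand-1 g49)

For `ξ_m = c_m/SC + Σ_e (aP m e/SC)·dispN (U − U_c) 0 e` (`hξσ`): the track point lies in the track box (`track_point_mem`), the folded displacement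
satisfies the graph identity with `A_me = aP m e/SC` in the `(A, hA)` form of parts G–P (`trackA_eq`, `track_graph'`), and hence ★★★ `slopeT2_sound'`:
`slopeT2_sound` with `hξσ` in place of `(hξ, A, hA, hgraph)`.  No definitions; 0 sorry; standard axioms.  `--supports stmt-AtomisticToContinuum-27623`.
-/

noncomputable section

namespace Summit.AtomisticToContinuum.Crystallization.Theorems.FrustratedLawDichotomyStrainedPatchHomValueT2Kit

open scoped BigOperators RealInnerProductSpace
open Finset
open Literature.Analysis.ValidatedNumerics.Numerics
open Summit.AtomisticToContinuum.Crystallization.Theorems.ChargedEnergyGapNegative (E3)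
open Summit.AtomisticToContinuum.Crystallization.Theorems.FrustratedLawDichotomySchurCut (effPot w₄₅ ω₄)
open Summit.AtomisticToContinuum.Crystallization.Theorems.FrustratedLawDichotomyStrainedPatchTaylorLeaves (junctions)
open Summit.AtomisticToContinuum.Crystallization.Theorems.FrustratedLawDichotomyStrainedPatchTaylorChord (segG)
open Summit.AtomisticToContinuum.Crystallization.Theorems.FrustratedLawDichotomyStrainedPatchHomSplit (latPt hexFrame hcpShift)
open Summit.AtomisticToContinuum.Crystallization.Theorems.FrustratedLawDichotomyStrainedPatchHomEntryGramHcp (shufFI)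
open Summit.AtomisticToContinuum.Crystallization.Theorems.FrustratedLawDichotomyStrainedPatchHomCurvCentreKit (boxE cenE cenX cenMap cenShuf cenShuf_apply)

/-- The track matrix as a total function on `ℕ × ℕ` reads `aP m e/SC` on `m < 3`, `e < 6`. [formal bookkeeping] -/
theorem trackA_eq (aP : Fin 3 → Fin 6 → ℤ) (m e : ℕ) (hm : m < 3) (he : e < 6) :
    (fun m e : ℕ => if hm : m < 3 then (if he : e < 6 then ((aP ⟨m, hm⟩ ⟨e, he⟩ : ℤ) : ℝ) / SC else 0) else 0) m e = ((aP ⟨m, hm⟩ ⟨e, he⟩ : ℤ) : ℝ) / SC := by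
  simp only [hm, he, dif_pos]

/-- ★ The graph identity in the `(A, hA)` form: `δ_{6+m} = Σ_{e<6} A_me δ_e`. [formal bookkeeping: `track_graph`] -/
theorem track_graph' {c : (Fin 3 × Fin 3) ⊕ Fin 3 → ℤ} (aP : Fin 3 → Fin 6 → ℤ) (U : E3 →L[ℝ] E3) (ξ : E3)
    (hξσ : ∀ m : Fin 3, ξ m = (c (Sum.inr m) : ℝ) / SC + ∑ e : Fin 6, ((aP m e : ℤ) : ℝ) / SC * dispN (U - cenMap c) 0 e) (m : ℕ) (hm : m < 3) :
    dispN (U - cenMap c) (ξ - cenShuf c) (6 + m) = ∑ e ∈ range 6, (fun m e : ℕ => if hm : m < 3 then (if he : e < 6 then ((aP ⟨m, hm⟩ ⟨e, he⟩ : ℤ) : ℝ) / SC else 0) else 0) m e * dispN (U - cenMap c) (ξ - cenShuf c) e := by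
  rw [track_graph aP U ξ hξσ hm]
  refine Finset.sum_congr rfl fun e he => ?_
  have he6 := Finset.mem_range.1 he
  have em : (⟨m % 3, Nat.mod_lt _ (by norm_num)⟩ : Fin 3) = ⟨m, hm⟩ := Fin.ext (Nat.mod_eq_of_lt hm)
  simp only [he6, hm, dif_pos, em]

/-- ★ **THE TRACK POINT LIES IN THE TRACK BOX**: `|ξ_i − c_i/SC| ≤ (trackW aP w)_i/SC` for `U` in the entry box (nonnegative shuffle slack, guard of the
track box). [folklore chaining: `abs_dispN_le`, `abs_track_le`] -/
theorem track_point_mem {c w : (Fin 3 × Fin 3) ⊕ Fin 3 → ℤ} (aP : Fin 3 → Fin 6 → ℤ)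
    (hc : ∀ a b : Fin 3, c (Sum.inl (a, b)) = c (Sum.inl (b, a))) (hwpos : ∀ p : Fin 9, 0 < foldW (trackW aP w) p) (hw_inr : ∀ m : Fin 3, 0 ≤ w (Sum.inr m))
    (U : E3 →L[ℝ] E3) (ξ : E3) (hsa : ∀ v v' : E3, ⟪U v, v'⟫ = ⟪v, U v'⟫)
    (hbox : ∀ ab : Fin 3 × Fin 3, |(U (EuclideanSpace.single ab.2 (1 : ℝ))) ab.1 - (c (Sum.inl ab) : ℝ) / SC| ≤ (w (Sum.inl ab) : ℝ) / SC)
    (hξσ : ∀ m : Fin 3, ξ m = (c (Sum.inr m) : ℝ) / SC + ∑ e : Fin 6, ((aP m e : ℤ) : ℝ) / SC * dispN (U - cenMap c) 0 e) (i : Fin 3) :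
    |ξ i - (c (Sum.inr i) : ℝ) / SC| ≤ ((trackW aP w) (Sum.inr i) : ℝ) / SC := by
  have hS := SC_pos
  have hbox' : ∀ ab : Fin 3 × Fin 3, |(U (EuclideanSpace.single ab.2 (1 : ℝ))) ab.1 - (c (Sum.inl ab) : ℝ) / SC| ≤ ((trackW aP w) (Sum.inl ab) : ℝ) / SC :=
    fun ab => hbox ab
  have hδU : ∀ k (hk : k < 9), |dispN (U - cenMap c) 0 k| ≤ (foldW (trackW aP w) ⟨k, hk⟩ : ℝ) / SC := by
    intro k hk
    have h := abs_dispN_le (c := c) (w := (trackW aP w)) U (cenShuf c) hsa hc hbox' (fun i => by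
      rw [cenShuf_apply, sub_self, abs_zero]; exact div_nonneg (w_inr_nonneg hwpos i) hS.le) k hk
    rw [sub_self] at h
    exact h
  rw [hξσ i, add_sub_cancel_left]
  refine (abs_track_le aP (trackW aP w) i (dispN (U - cenMap c) 0) (fun e => hδU e (by omega))).trans ?_
  have e1 : ((trackW aP w) (Sum.inr i) : ℤ) = w (Sum.inr i) + driftW aP w i := rfl
  have e2 : driftW aP (trackW aP w) i = driftW aP w i := by unfold driftW; rfl
  rw [e2, e1]; push_cast
  have h0 : (0 : ℝ) ≤ w (Sum.inr i) := by exact_mod_cast hw_inr i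
  exact div_le_div_of_nonneg_right (by linarith) hS.le

/-- ★★★ **`slopeT2_sound'` — the slope report's (I1) theorem stated on the affine track `hξσ`** (entry box of `w`, guard of the track box, nonnegative
shuffle slack). [folklore chaining: part P + the plumbing above] -/
theorem slopeT2_sound' {c w : (Fin 3 × Fin 3) ⊕ Fin 3 → ℤ} {aP : Fin 3 → Fin 6 → ℤ} {G : Fin 3 → ℤ} (hflag : (t2SlopeT2 c w aP).1 = true)
    (hG : (t2SlopeT2 c w aP).2.1 = (G 0, G 1, G 2))
    (hc : ∀ a b : Fin 3, c (Sum.inl (a, b)) = c (Sum.inl (b, a))) (hw_inr : ∀ m : Fin 3, 0 ≤ w (Sum.inr m))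
    (hwpos : ∀ p : Fin 9, 0 < foldW (trackW aP w) p) (hw1 : ∀ p : Fin 9, foldW (trackW aP w) p ≤ (SC : ℤ))
    (U : E3 →L[ℝ] E3) (ξ : E3) (hsa : ∀ v v' : E3, ⟪U v, v'⟫ = ⟪v, U v'⟫)
    (hbox : ∀ ab : Fin 3 × Fin 3, |(U (EuclideanSpace.single ab.2 (1 : ℝ))) ab.1 - (c (Sum.inl ab) : ℝ) / SC| ≤ (w (Sum.inl ab) : ℝ) / SC)
    (hξσ : ∀ m : Fin 3, ξ m = (c (Sum.inr m) : ℝ) / SC + ∑ e : Fin 6, ((aP m e : ℤ) : ℝ) / SC * dispN (U - cenMap c) 0 e)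
    (hJB : ∀ b ∈ (nearB c (trackW aP w)), ‖latPt (cenMap c) hexFrame b + cenMap c (hcpShift + cenShuf c)‖ ∉ junctions) (Δ : E3) :
    |∑ b ∈ (Fintype.piFinset fun _ : Fin 3 => Finset.Icc (-7 : ℤ) 7), segG (deriv (effPot w₄₅ ω₄ (3 / 400))) (latPt U hexFrame b + U (hcpShift + ξ)) Δ 0| ≤
      Real.sqrt (∑ a : Fin 3, (((G a + 41 * ((nearB c (trackW aP w)).length : ℤ) : ℤ)) : ℝ) ^ 2) / SC * ‖Δ‖ :=
  slopeT2_sound hflag hG hc hwpos hw1 U ξ hsa (fun ab => hbox ab) (track_point_mem aP hc hwpos hw_inr U ξ hsa hbox hξσ)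
    (fun m e : ℕ => if hm : m < 3 then (if he : e < 6 then ((aP ⟨m, hm⟩ ⟨e, he⟩ : ℤ) : ℝ) / SC else 0) else 0) (trackA_eq aP) (track_graph' aP U ξ hξσ) hJB Δ

end Summit.AtomisticToContinuum.Crystallization.Theorems.FrustratedLawDichotomyStrainedPatchHomValueT2Kit
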